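import Summits.FinalStateConjecture.FinalStateConjecture.Theorems.ZeroEnergyKerrOrBombStationaryLimitReductionKerrIsometryRigidityWave3EndMatching
import Summits.FinalStateConjecture.FinalStateConjecture.Theorems.ZeroEnergyKerrOrBombStationaryLimitReductionRecutCoveringJunctionCore
import Summits.FinalStateConjecture.FinalStateConjecture.Theorems.ZeroEnergyKerrOrBombStationaryLimitReductionMoncriefDualityReductionWave3
import Summits.FinalStateConjecture.FinalStateConjecture.Theorems.ZeroEnergyKerrOrBombStationaryLimitReductionMoncriefFactsWave3
import Literature.Geometry.Lorentzian.KerrKillingAlgebra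
import Literature.Geometry.Lorentzian.KerrBackwardsIsometry
import Literature.Geometry.Lorentzian.SchwarzschildKillingAlgebra
import Literature.Geometry.Lorentzian.LocalConstraintDeformation
import HarnessLib

/-!
# Route ZeroEnergyKerrOrBomb · crux `StationaryLimitReduction` — registered stub STATEMENTS of reshape r6 of the
# line `symplectic-dual-of-the-bomb` (`Sig6.stub_*`: the irreducible residuals isolated by wave 3; definitions +
# the three kernel-checked reductions to the r4/r5 statements)

Fourth statement module of the line (after `…SymplecticDualOfTheBombDefs/Defs2/Sig/Sig4`, p101414 / p114429 / p116416 /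
p123321), crux stmt-FinalStateConjecture-10021 (`ZeroEnergyKerrOrBomb.StationaryLimitReduction := KerrOrBomb →
FinalStateConjecture`), lead prover-line-stmt-FinalStateConjecture-10021-a2-0, 2026-08-16. Wave 3 proved the r5 stubs 1R
(`Sig4.stub_kerrIsometryRigidity`), 1G (`Sig4.stub_recutCovering`) and 4 (`Sig.stub_moncriefFacts`) MODULO named residual
propositions (landed as definitions: `KerrHorizonExtension`, `KerrAsymptoticRigidity` — p125844; `RecutJunctionCore` — p125072;
`LocalSingleDetectionAt` — p124620) and four CITED, UNPROVED Literature named facts (`ONeill1995_kerrKillingFields` p116586,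
`StephaniEtAl2003_schwarzschildKillingFields` p124902, `ONeill1995_kerrBackwardsIsometry` p124901,
`ChruscielDelay_localConstraintDeformation` p124600), with the reductions kernel-checked (p126702, p125072, p124620/p124601).
Reshape r6 of the skeleton registers exactly those residuals. As with `Sig`/`Sig4`, each registered stub is
`theorem stub_X : Sig6.stub_X`, so that (i) the skeleton's composition takes every obligation BY NAME and (ii) helper and
closing files can import the statements:

* `Sig6.stub_citedFacts` — the conjunction of the four cited Literature facts the line consumes (LITERATURE DEBT: closed by
  the four `_holds` theorems the day literature-provers discharge them; not a worker stub);
* `Sig6.stub_kerrIsometryResiduals` — `KerrHorizonExtension ∧ KerrAsymptoticRigidity` (F3 ∧ F4 of stub 1R);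
* `Sig6.stub_recutJunctionCore` — `RecutJunctionCore` (the flat/Kerr–Schild slab junction, residual of stub 1G);
* `Sig6.stub_singleDetection` — the localised Moncrief annihilator lemma in single-detector form (residual of stub 4);
* §2 the three reductions `kerrIsometryRigidity_of_sig6`, `recutCovering_of_sig6`, `moncriefFacts_of_sig6` (sorry-free).

Definitions of propositions only (nothing asserted) plus three proved reductions; no route file is imported; the stub
statements carry `(ref: …)` prose, not cite tags (they are obligations of the line, not published facts — precedent
`…SymplecticDualOfTheBombSig.lean`).
-/

-- every `Summit.FinalStateConjecture.FinalStateConjecture.…` name repeats the summit = sub-problem segment (D-0017 layout)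
set_option linter.dupNamespace false
set_option maxSynthPendingDepth 3

noncomputable section

open scoped Manifold ContDiff Topology BigOperators
open Set Filter Bundle MeasureTheory Literature.Geometry.Lorentzian

namespace Summit.FinalStateConjecture.FinalStateConjecture.Theorems.SymplecticDualOfTheBomb

open Summit.FinalStateConjecture.FinalStateConjecture.Theorems.OneLockedExplosion

/-! ## §1 The registered stub statements of reshape r6 (precise `Prop`s `Sig6.stub_<name>`) -/

/-- **Stub r6-L · `citedFacts` (LITERATURE DEBT)** — the four cited, not yet discharged Literature named facts consumed by
the line's reductions: the Killing algebra of the slow Kerr exterior block (O'Neill 1995, Cor. 3.7.4), the Killing algebra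
of the Schwarzschild exterior (Stephani et al. 2003, §38.2 with §15.4), the backwards isometry `(t, φ) ↦ (−t, −φ)` of the
Kerr exterior block (O'Neill 1995, §3.1), and the local constraint deformation off germ-KIDs (Chruściel–Delay 2003,
Thm. 5.9 / Prop. 5.10 / Cor. 5.11 with Corvino–Schoen 2006, Thm. 2). Each conjunct is a `def … : Prop` of `Literature/`
(p116586, p124902, p124901, p124600); this stub is closed by their `_holds` theorems and by nothing else.
(ref: ONeill1995, Ch. 3 §3.7 Cor. 3.7.4 and §3.1; ChruscielDelay2003, Thm. 5.9) -/
def Sig6.stub_citedFacts : Prop :=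
  ONeill1995_kerrKillingFields ∧ StephaniEtAl2003_schwarzschildKillingFields ∧ ONeill1995_kerrBackwardsIsometry ∧
    Literature.Geometry.Lorentzian.ChruscielDelay_localConstraintDeformation

/-- **Stub r6-1R · `kerrIsometryResiduals`** — what remains of Kerr isometry rigidity (`Sig4.stub_kerrIsometryRigidity`)
after wave 3 (p126702 proves it from `Sig6.stub_citedFacts`'s first three conjuncts, the PROVED end matching
`kerrEndMatching_of_killingAlgebras`, and these two): F3 `KerrHorizonExtension` — C^∞ boundary regularity across `𝓗⁺` of
the future-normalised `T`-equivariant d.o.c. isometry, read in horizon-regular charts, followed by an injective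
equivariant continuation into the collar (unprinted as a theorem; ingredients Chruściel–Costa 2008 §4.1–4.3) — and F4
`KerrAsymptoticRigidity` — bounded tilt / radial distortion / derivatives of orders 1–3 at `i⁰` for a `T`-equivariant
isometry into an asymptotically Schwarzschildean (C²-rate) adapted chart sending infinity to infinity (the mass-matched
second-order asymptotic argument; the tree's Bartnik transition rigidity gives only `O(r^{1−α})` drift). Both `Prop`s are
the definitions of `…KerrIsometryRigidityWave3Facts` (p125844). (ref: ChruscielCosta2008, Thm. 1.3 with §4.3 Thm. 4.11; Bartnik1986, Cor. 3.2) -/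
def Sig6.stub_kerrIsometryResiduals : Prop :=
  KerrHorizonExtension ∧ KerrAsymptoticRigidity

/-- **Stub r6-1G · `recutJunctionCore`** — the source-free flat/Kerr–Schild slab junction of the naive recut
(`RecutJunctionCore`, p125072): below the old d.o.c. hole slabs of chart time `τ₁` or inside the old certified tubes,
every point not yet recut-certified-late is causally before the flat slab at `τ₁` or a recut Kerr–Schild truncated slab,
for recut radii `R'ᵢ τ = Rᵢ (cᵢ τ − s) − W`. Wave 3 proved `Sig4.stub_recutCovering` from it (`stub_recutCovering_of_core`,
on the proved growing-radius transfer p124807 and the `N = 0` case p124506), exhibited an honest `N = 1` model of all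
r4 hypotheses and checked that the Schwarzschild witness V2 of wave 2 no longer bites. Absent from tree and print
(size XL: C⁰ cone comparison from `truncDeviationCk`, causal model flows off the horizon strip, chart times monotone along
causal curves). (ref: DafermosLuk2017, Conjecture 1 (b)–(c)) -/
def Sig6.stub_recutJunctionCore : Prop :=
  RecutJunctionCore

/-- **Stub r6-4 · `singleDetection`** — the LOCALISED Moncrief annihilator lemma, single-detector form
(`LocalSingleDetectionAt`, p124620): at every point `x₀`, a symmetric detector pair which is not a local slice tangent
at `x₀` is paired non-trivially (ADM form read in the chart at `x₀`) by some compactly supported, integrable solution of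
the linearised vacuum constraints inside any chart neighbourhood `U ∋ x₀` on which the detector is smooth. Wave 3 reduced
`Sig.stub_moncriefFacts` to it plus the cited fact `ChruscielDelay_localConstraintDeformation`
(`stub_moncriefFacts_of_facts`, `localMoncriefDuality_of_singleDetection`: k detectors ⇐ single detection by linear
algebra on the detection rows; `localConstraintDeformationAt_of_fact`, p124601). Printed only GLOBALLY (Moncrief 1975,
Fischer–Marsden–Moncrief 1980); the localisation (closed range of `J∘DΦ*` on weighted spaces over balls, Chruściel–Delay
2003 Thm. 3.6/5.9, + interior elliptic regularity of the KID operator) is routine but unprinted.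
(ref: Wald1984GR, Appendix E.2; ChruscielDelay2003, Thm. 3.6) -/
def Sig6.stub_singleDetection : Prop :=
  ∀ (X : Type) [TopologicalSpace X] [ChartedSpace E3 X] [IsManifold (𝓡 3) ∞ X]
    [T2Space X] [SecondCountableTopology X] [ConnectedSpace X] (D : InitialDataSet (𝓡 3) X)
    (𝒟 : VacuumCauchyDevelopment D) (x₀ : X), LocalSingleDetectionAt 𝒟 x₀

/-! ## §2 The three reductions of the r5 statements to the r6 residuals (sorry-free; registered helpers) -/

/-- **`Sig4.stub_kerrIsometryRigidity` from the cited facts and the two 1R residuals** (wave 3, p126702: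
`stub_kerrIsometryRigidity_of_extension_and_rigidity`). [folklore] -/
theorem kerrIsometryRigidity_of_sig6 : Sig6.stub_citedFacts → Sig6.stub_kerrIsometryResiduals → Sig4.stub_kerrIsometryRigidity :=
  fun hF hR ↦ stub_kerrIsometryRigidity_of_extension_and_rigidity hF.1 hF.2.1 hF.2.2.1 hR.1 hR.2

/-- **`Sig4.stub_recutCovering` from the junction core** (wave 3, p125072: `stub_recutCovering_of_core`). [folklore] -/
theorem recutCovering_of_sig6 : Sig6.stub_recutJunctionCore → Sig4.stub_recutCovering :=
  fun h ↦ stub_recutCovering_of_core h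

/-- **`Sig.stub_moncriefFacts` from the cited facts and single detection** (wave 3, p124620 + p124601:
`stub_moncriefFacts_of_facts`, `localConstraintDeformationAt_of_fact`). [folklore] -/
theorem moncriefFacts_of_sig6 : Sig6.stub_citedFacts → Sig6.stub_singleDetection → Sig.stub_moncriefFacts :=
  fun hF hS ↦ stub_moncriefFacts_of_facts (localConstraintDeformationAt_of_fact hF.2.2.2) hS

end Summit.FinalStateConjecture.FinalStateConjecture.Theorems.SymplecticDualOfTheBomb

end
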